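import Mathlib
import Summits.Ventures.HodgeRepro2.T5SmoothIsotypic
import Summits.Ventures.HodgeRepro2.T5ConductorArithmetic
import Summits.Ventures.HodgeRepro2.T6N5TateTwist
import Summits.Ventures.HodgeRepro2.T6N5Hyp
import Summits.Ventures.HodgeRepro2.T6N5LocalDatum
import Summits.Ventures.HodgeRepro2.T6N5LocalHyp
import Summits.Ventures.HodgeRepro2.T6N5Local
import Summits.Ventures.HodgeRepro2.T6N5LocalWeil
import Summits.Ventures.HodgeRepro2.T6N5LocalCharDatum
import Summits.Ventures.HodgeRepro2.T6N5LocalRamHyp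
import Summits.Ventures.HodgeRepro2.T6N5LocalRam
import Summits.Ventures.HodgeRepro2.T6N5LocalRamToy
import Summits.Ventures.HodgeRepro2.T6N5LocalRamWeil

/-!
# T6N5LocalRamWeilToy — the non-vacuity witness for `T6N5LocalRamWeil` (README §10.5(ii)(c),(d))

A `RamWeilDatum` on which EVERY binder of `N5LocalRamWeil.RamWeilDatum.N5Local_main_ram_weil` holds jointly — with
the theta predicate DEFINED from a carried Weil representation: over the ramified toy `N5LocalRamToy.toy`
(`E = Multiplicative ℤ × (ℕ → ℤˣ)`, `π = (1, 1)`, `F_v^× = ⟨π²⟩`), the compact group `U(V) = E¹ = E/F_v^×` is the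
QUOTIENT `E ⧸ ⟨π²⟩` written additively (`ToyA`), `ofOne α = α ∘ j` with `j` the quotient map (so every `α_K` is
conjugate-orthogonal by construction — the toy's `j(F_v^×) = 1`), the conjugate-orthogonal characters of `E` are
exactly the characters of the quotient (`toyToAddChar` / `toyOfOne_toyToAddChar`), and the Weil representation of
the line `V_s` is modelled as the direct sum of the characters the ε-dichotomy predicts for `V_s`:
`Wsp s = Good s →₀ ℂ` (`Good s` = the conjugate-orthogonal `ξ` with `ε_v(χ_W⁻¹·ξ) = s·ϵ_δ(W)`) with the diagonal
action through the lifted characters. The `α`-isotypic component is non-zero iff `α_K ∈ Good s` (`thetaOf_iff`), so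
the Epsilon Dichotomy display holds for the DEFINED theta (`toyWeil_h35`); the representation is smooth because the
quotient `E/⟨π²⟩` has exponent `2`, so every character of it has a kernel of index `≤ 2` (`toyWeil_smooth`); both
spaces are non-zero because both signs occur (`toy_hA1`). `toyRamWeil_solution` applies `N5Local_main_ram_weil`.
README §8(d): uses an L-value-free non-vanishing device: NO.
-/

namespace Summit.Ventures.HodgeRepro2.T6.N5LocalRamWeilToy

open Summit.Ventures.HodgeRepro2.T6.N5LocalDatum Summit.Ventures.HodgeRepro2.T6.N5LocalWeil
  Summit.Ventures.HodgeRepro2.T6.N5LocalCharDatum Summit.Ventures.HodgeRepro2.T6.N5LocalCharDatum.CharDatum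
  Summit.Ventures.HodgeRepro2.T6.N5LocalRamDatum Summit.Ventures.HodgeRepro2.T6.N5Local
  Summit.Ventures.HodgeRepro2.T6.N5LocalRam Summit.Ventures.HodgeRepro2.T6.N5LocalRamToy
  Summit.Ventures.HodgeRepro2.T6.N5LocalRamWeil Summit.Ventures.HodgeRepro2.T6.Hyp
  Summit.Ventures.HodgeRepro2.T5SmoothIsotypic

noncomputable section

/-- `F_v^× = ⟨π²⟩` of the ramified toy. -/
abbrev FsubQ : Subgroup ToyE := Subgroup.zpowers (toyπ * toyπ)

/-- The quotient `E¹ = E/F_v^×` of the toy. -/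
abbrev ToyQ : Type := ToyE ⧸ FsubQ

/-- `A = U(V) = E¹`: the quotient written additively. -/
abbrev ToyA : Type := Additive ToyQ

/-- Every element of the quotient `E/⟨π²⟩` has order `≤ 2`. -/
theorem toyQ_mul_self (q : ToyQ) : q * q = 1 := by
  induction q using QuotientGroup.induction_on with
  | H x =>
    rw [← QuotientGroup.mk_mul, QuotientGroup.eq_one_iff]
    refine Subgroup.mem_zpowers_iff.mpr ⟨Multiplicative.toAdd x.1, ?_⟩
    refine Prod.ext ?_ ?_
    · change (toyπ * toyπ).1 ^ Multiplicative.toAdd x.1 = x.1 * x.1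
      apply Multiplicative.toAdd.injective
      simp only [toyπ, Prod.fst_mul, toAdd_mul, toAdd_zpow, toAdd_ofAdd, smul_eq_mul]
      ring
    · change (toyπ * toyπ).2 ^ Multiplicative.toAdd x.1 = x.2 * x.2
      funext i
      simp [toyπ, Int.units_mul_self]

/-- A conjugate-orthogonal character of `E` kills `F_v^× = ⟨π²⟩`. -/
theorem le_ker_of_isCO {ξ : ToyE →* ℂˣ} (h : toy.toLocalSignDatum.IsCO ξ) : FsubQ ≤ ξ.ker :=
  Subgroup.zpowers_le.mpr (MonoidHom.mem_ker.mpr ((toy_isCO_iff ξ).mp h))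

/-- The characters occurring in the Weil representation of the line `V_s`: the conjugate-orthogonal characters
whose root number `ε_v(χ_W⁻¹·ξ)` equals `s·ϵ_δ(W)` — the right side of the Epsilon Dichotomy for `V_s`. -/
def Good (s : ℤˣ) : Set (ToyE →* ℂˣ) :=
  {ξ | toy.toLocalSignDatum.IsCO ξ ∧
    toy.toLocalSignDatum.eps (toy.toLocalSignDatum.χW⁻¹ * ξ) = s * toy.toLocalSignDatum.epsdW}

/-- A character in `Good s`, lifted to the quotient `E¹ = E/⟨π²⟩`. -/
def liftG {s : ℤˣ} (ξ : Good s) : ToyQ →* ℂˣ := QuotientGroup.lift FsubQ ξ.1 (le_ker_of_isCO ξ.2.1)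

/-- The lifted character on the class of `x`. -/
theorem liftG_mk {s : ℤˣ} (ξ : Good s) (x : ToyE) : liftG ξ (x : ToyQ) = ξ.1 x :=
  QuotientGroup.lift_mk FsubQ _ x

/-- Evaluation of a lifted character at an element of `Multiplicative A`, as a complex number. -/
def evalAt {s : ℤˣ} (ξ : Good s) (g : Multiplicative ToyA) : ℂ :=
  ((liftG ξ (Additive.toMul (Multiplicative.toAdd g)) : ℂˣ) : ℂ)

/-- `evalAt` at the identity. -/
theorem evalAt_one {s : ℤˣ} (ξ : Good s) : evalAt ξ 1 = 1 := by
  simp [evalAt]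

/-- `evalAt` is multiplicative. -/
theorem evalAt_mul {s : ℤˣ} (ξ : Good s) (g h : Multiplicative ToyA) :
    evalAt ξ (g * h) = evalAt ξ g * evalAt ξ h := by
  simp [evalAt, toAdd_mul, toMul_add]

/-- `evalAt` at `ofAdd (ofMul (x : E¹))`: the value of the character at `x`. -/
theorem evalAt_ofAdd_mk {s : ℤˣ} (ξ : Good s) (x : ToyE) :
    evalAt ξ (Multiplicative.ofAdd (Additive.ofMul (x : ToyQ))) = ((ξ.1 x : ℂˣ) : ℂ) := by
  simp [evalAt, liftG_mk]

/-- `ofOne`: an additive character of `A = E¹` read as a character of `E` through the quotient map `j`. -/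
def toyOfOne (α : AddChar ToyA ℂ) : ToyE →* ℂˣ :=
  (α.toMonoidHom.toHomUnits.comp (MulEquiv.multiplicativeAdditive ToyQ).symm.toMonoidHom).comp
    (QuotientGroup.mk' FsubQ)

/-- The value of `toyOfOne α`. -/
theorem toyOfOne_apply (α : AddChar ToyA ℂ) (x : ToyE) :
    ((toyOfOne α x : ℂˣ) : ℂ) = α (Additive.ofMul (x : ToyQ)) := by
  simp [toyOfOne, MonoidHom.coe_toHomUnits]

/-- Every `α_K = α ∘ j` is conjugate-orthogonal (`j(F_v^×) = 1`). -/
theorem toyOfOne_isCO (α : AddChar ToyA ℂ) : toy.toLocalSignDatum.IsCO (toyOfOne α) := by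
  rw [toy_isCO_iff]
  refine Units.ext ?_
  rw [toyOfOne_apply, Units.val_one]
  have h : ((toyπ * toyπ : ToyE) : ToyQ) = 1 :=
    (QuotientGroup.eq_one_iff _).mpr (Subgroup.mem_zpowers _)
  rw [h, ofMul_one, AddChar.map_zero_eq_one]

/-- The additive character of `A = E¹` attached to a conjugate-orthogonal character of `E`. -/
def toyToAddChar (ξ : ToyE →* ℂˣ) (h : toy.toLocalSignDatum.IsCO ξ) : AddChar ToyA ℂ where
  toFun a := ((QuotientGroup.lift FsubQ ξ (le_ker_of_isCO h) (Additive.toMul a) : ℂˣ) : ℂ)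
  map_zero_eq_one' := by simp
  map_add_eq_mul' a b := by simp [toMul_add]

/-- The value of `toyToAddChar ξ h`. -/
theorem toyToAddChar_apply (ξ : ToyE →* ℂˣ) (h : toy.toLocalSignDatum.IsCO ξ) (a : ToyA) :
    toyToAddChar ξ h a = ((QuotientGroup.lift FsubQ ξ (le_ker_of_isCO h) (Additive.toMul a) : ℂˣ) : ℂ) := rfl

/-- `toyOfOne ∘ toyToAddChar = id`: every conjugate-orthogonal character of `E` is an `α_K`. -/
theorem toyOfOne_toyToAddChar (ξ : ToyE →* ℂˣ) (h : toy.toLocalSignDatum.IsCO ξ) :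
    toyOfOne (toyToAddChar ξ h) = ξ := by
  refine MonoidHom.ext fun x => Units.ext ?_
  rw [toyOfOne_apply, toyToAddChar_apply, toMul_ofMul, QuotientGroup.lift_mk]

/-- The space of the toy Weil representation of `V_s`: finitely supported functions on `Good s`. -/
abbrev Wsp (s : ℤˣ) : Type := Good s →₀ ℂ

/-- The diagonal action of `g` on `Wsp s`: `(g · v)(ξ) = ξ(g) v(ξ)`. -/
def toyOp (s : ℤˣ) (g : Multiplicative ToyA) : Wsp s →ₗ[ℂ] Wsp s where
  toFun v := (fun ξ : Good s => evalAt ξ g) • v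
  map_add' v w := by
    ext ξ
    simp [mul_add]
  map_smul' c v := by
    ext ξ
    simp [mul_left_comm]

/-- Coordinates of the diagonal action. -/
theorem toyOp_apply (s : ℤˣ) (g : Multiplicative ToyA) (v : Wsp s) (ξ : Good s) :
    toyOp s g v ξ = evalAt ξ g * v ξ := by
  simp [toyOp]

/-- The toy Weil representation of the line `V_s`. -/
def toyRho (s : ℤˣ) : Representation ℂ (Multiplicative ToyA) (Wsp s) where
  toFun := toyOp s
  map_one' := by
    refine LinearMap.ext fun v => Finsupp.ext fun ξ => ?_
    simp [toyOp_apply, evalAt_one]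
  map_mul' g h := by
    refine LinearMap.ext fun v => Finsupp.ext fun ξ => ?_
    simp [toyOp_apply, evalAt_mul, mul_assoc]

/-- `toyRho` acts by `toyOp`. -/
theorem toyRho_apply (s : ℤˣ) (g : Multiplicative ToyA) (v : Wsp s) (ξ : Good s) :
    toyRho s g v ξ = evalAt ξ g * v ξ :=
  toyOp_apply s g v ξ

/-- The toy ramified Weil datum. -/
abbrev toyWeil : RamWeilDatum where
  D := toy
  A := ToyA
  Wsp := Wsp
  ωWeil := toyRho
  ofOne := toyOfOne

/-- `e_ξ` lies in the `ξ`-isotypic component of the Weil representation of `V_s` (`ξ ∈ Good s`). -/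
theorem single_mem_isotypic (s : ℤˣ) (ξ : Good s) :
    Finsupp.single ξ (1 : ℂ) ∈ isotypic (toyRho s) (toyToAddChar ξ.1 ξ.2.1) := by
  show ∀ a : ToyA, toyRho s (Multiplicative.ofAdd a) (Finsupp.single ξ 1) =
    toyToAddChar ξ.1 ξ.2.1 a • Finsupp.single ξ 1
  intro a
  classical
  induction a using Additive.rec with
  | ofMul q =>
    induction q using QuotientGroup.induction_on with
    | H x =>
      ext ζ
      rw [toyRho_apply, Finsupp.smul_apply, evalAt_ofAdd_mk, toyToAddChar_apply, toMul_ofMul,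
        QuotientGroup.lift_mk, smul_eq_mul, Finsupp.single_apply]
      split_ifs with h
      · subst h
        rfl
      · simp

/-- A non-zero vector of the `α`-isotypic component forces `α_K ∈ Good s`. -/
theorem toyOfOne_mem_good_of_mem_isotypic {s : ℤˣ} {α : AddChar ToyA ℂ} {v : Wsp s}
    (hv : v ∈ isotypic (toyRho s) α) (hv0 : v ≠ 0) : toyOfOne α ∈ Good s := by
  have hv' : ∀ a : ToyA, toyRho s (Multiplicative.ofAdd a) v = α a • v := hv
  obtain ⟨ξ, hξ⟩ := Finsupp.support_nonempty_iff.mpr hv0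
  have hξ0 : v ξ ≠ 0 := Finsupp.mem_support_iff.mp hξ
  have heq : toyOfOne α = ξ.1 := by
    refine MonoidHom.ext fun x => Units.ext ?_
    have h := congrArg (fun w : Wsp s => w ξ) (hv' (Additive.ofMul (x : ToyQ)))
    simp only [toyRho_apply, Finsupp.smul_apply, evalAt_ofAdd_mk, smul_eq_mul] at h
    rw [toyOfOne_apply]
    exact (mul_right_cancel₀ hξ0 h).symm
  rw [heq]
  exact ξ.2

/-- The DEFINED theta predicate of the toy is membership in `Good s`. -/
theorem thetaOf_iff (s : ℤˣ) (ξ : ToyE →* ℂˣ) : toyWeil.toWeil.thetaOf s ξ ↔ ξ ∈ Good s := by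
  constructor
  · rintro ⟨α, rfl, hne⟩
    obtain ⟨v, hv, hv0⟩ := (Submodule.ne_bot_iff _).mp hne
    exact toyOfOne_mem_good_of_mem_isotypic hv hv0
  · intro h
    refine ⟨toyToAddChar ξ h.1, toyOfOne_toyToAddChar ξ h.1, ?_⟩
    rw [Submodule.ne_bot_iff]
    exact ⟨Finsupp.single ⟨ξ, h⟩ 1, single_mem_isotypic s ⟨ξ, h⟩, Finsupp.single_ne_zero.mpr one_ne_zero⟩

/-- The Epsilon Dichotomy display holds on the toy Weil datum, for the theta predicate DEFINED from the carried
Weil representation. -/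
theorem toyWeil_h35 : BFGYYZ2025_Thm3_5 toyWeil.toWeil.toLocalSignDatum := by
  intro s α hα
  show toyWeil.toWeil.thetaOf s α ↔ _
  rw [thetaOf_iff]
  exact ⟨fun h => h.2, fun h => ⟨hα, h⟩⟩

/-- Every character of the quotient `E¹` takes the values `±1` only. -/
theorem val_mul_self (χ : ToyQ →* ℂˣ) (q : ToyQ) : χ q * χ q = 1 := by
  rw [← map_mul, toyQ_mul_self, map_one]

/-- The range of a character of `E¹` is finite (`⊆ {1, −1}`). -/
theorem range_finite (χ : ToyQ →* ℂˣ) : Finite χ.range := by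
  have hsub : (χ.range : Set ℂˣ) ⊆ {1, -1} := by
    rintro y ⟨q, rfl⟩
    have h := val_mul_self χ q
    have h' : ((χ q : ℂˣ) : ℂ) * ((χ q : ℂˣ) : ℂ) = 1 := by
      rw [← Units.val_mul, h, Units.val_one]
    simp only [Set.mem_insert_iff, Set.mem_singleton_iff]
    rcases mul_self_eq_one_iff.mp h' with h1 | h1
    · exact Or.inl (Units.ext h1)
    · exact Or.inr (Units.ext (by rw [h1]; rfl))
  exact ((Set.toFinite _).subset hsub).to_subtype

/-- The kernel of a character of `E¹`, as an additive subgroup of `A`, has finite index. -/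
theorem kerA_finiteIndex (χ : ToyQ →* ℂˣ) : (Subgroup.toAddSubgroup χ.ker).FiniteIndex := by
  haveI := range_finite χ
  have h : χ.ker.FiniteIndex := Subgroup.finiteIndex_ker χ
  refine AddSubgroup.finiteIndex_iff.mpr ?_
  rw [Subgroup.index_toAddSubgroup]
  exact Subgroup.finiteIndex_iff.mp h

/-- The stabiliser of a vector: the intersection of the kernels of the (lifted) characters in its support. -/
def stab (s : ℤˣ) (v : Wsp s) : AddSubgroup ToyA :=
  ⨅ ξ : v.support, Subgroup.toAddSubgroup (liftG ξ.1).ker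

/-- The stabiliser has finite index. -/
theorem stab_finiteIndex (s : ℤˣ) (v : Wsp s) : (stab s v).FiniteIndex :=
  AddSubgroup.finiteIndex_iInf fun ξ => kerA_finiteIndex (liftG ξ.1)

/-- The vector is fixed by its stabiliser. -/
theorem mem_fixedBy_stab (s : ℤˣ) (v : Wsp s) : v ∈ fixedBy (toyRho s) (stab s v) := by
  show ∀ k ∈ stab s v, toyRho s (Multiplicative.ofAdd k) v = v
  intro k hk
  ext ξ
  rw [toyRho_apply]
  by_cases hξ : ξ ∈ v.support
  · have hker : Additive.toMul k ∈ (liftG ξ).ker := AddSubgroup.mem_iInf.mp hk ⟨ξ, hξ⟩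
    rw [MonoidHom.mem_ker] at hker
    simp only [evalAt, toAdd_ofAdd, hker, Units.val_one, one_mul]
  · rw [Finsupp.notMem_support_iff.mp hξ, mul_zero]

/-- The toy Weil representations are smooth. -/
theorem toyWeil_smooth (s : ℤˣ) : toyWeil.toWeil.IsSmoothCompact s := by
  intro v
  haveI := stab_finiteIndex s v
  haveI : Finite (ToyA ⧸ stab s v) := AddSubgroup.finite_quotient_of_finiteIndex
  exact ⟨stab s v, ⟨Fintype.ofFinite _⟩, mem_fixedBy_stab s v⟩

/-- Both signs occur: `Good s` is non-empty for every `s` (`toy_hA1` + `toy_h35`). -/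
theorem good_nonempty (s : ℤˣ) : ∃ ξ, ξ ∈ Good s := by
  obtain ⟨α, hα, hΘ⟩ := toy_hA1 s
  exact ⟨α, hα, (toy_h35 s α hα).mp hΘ⟩

/-- The toy Weil representations are non-zero. -/
instance instNontrivialWsp (s : ℤˣ) : Nontrivial (Wsp s) := by
  obtain ⟨ξ, hξ⟩ := good_nonempty s
  exact ⟨⟨Finsupp.single ⟨ξ, hξ⟩ 1, 0, Finsupp.single_ne_zero.mpr one_ne_zero⟩⟩

/-- `j(F_v^×) = 1`: every `α_K` is conjugate-orthogonal on the toy. -/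
theorem toyWeil_hofOne (α : AddChar ToyA ℂ) :
    toyWeil.toWeil.toLocalSignDatum.IsCO (toyWeil.toWeil.ofOne α) :=
  toyOfOne_isCO α

/-- EVERY binder of `N5Local_main_ram_weil` holds on the toy Weil datum — with the theta predicate DEFINED from the
carried Weil representation — and the coupled local system is solved there
(README §10.5(ii)(c),(d) for `T6N5LocalRamWeil`). -/
theorem toyRamWeil_solution :
    ∃ ξ : Fin 4 → toyWeil.toWeil.toLocalSignDatum.Char, LocalSolution toyWeil.toWeil.toLocalSignDatum ξ :=
  toyWeil.N5Local_main_ram_weil toy_T6 toy_G51 toyU_antitone toy_hω rfl toy_hμ toy_hodd toy_heven toyWeil_h35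
    toyWeil_smooth toyWeil_hofOne rfl (mul_one (1 : FsubQ →* ℂˣ)) ((toy_isCS_iff 1).mpr (by simp))

end

end Summit.Ventures.HodgeRepro2.T6.N5LocalRamWeilToy
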